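import Literature.Geometry.Lorentzian.KerrLeafEnergyComparison
import Literature.Geometry.Lorentzian.KerrNullFrame
import HarnessLib

/-!
# The outgoing null vector `m` of the Kerr–Schild null frame is future-directed: the dominant
# energy condition for the `r^p` multiplier `f(r) m`

(family `gr`; infrastructure for the far-region `r^p`-weighted estimates behind statement **gr.S24**
— the named fact `Kerr.dafermosRodnianski_pHierarchy_scri` of `KerrDecayHierarchy.lean`;
namespace `Literature.Geometry.Lorentzian.Kerr`)

`KerrNullFrame.lean` introduces the exact outgoing null vector `m = 2∂_{t*} + (1 − 2H)ℓ♯` of the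
`(∂_{t*}, ℓ♯)`-plane of the Kerr–Schild chart (`Kerr.outVector`), along which the `r^p` multiplier
`X = f(r) m` of Dafermos–Rodnianski points. This file records its causal character for the Kerr time
orientation `V = −g♯dt*` of the tree (`Kerr.timeOrientation`): at every exterior point

* `Kerr.isFutureDirected_outVector` — **`m` is future-directed causal (null)**: `g(m, m) = 0`,
  `m⁰ = 1 + 2H ≠ 0`, `g(V, m) = −(1 + 2H) < 0` (`M ≥ 0`);
* `Kerr.isFutureDirected_smul_outVector` — so is `f m` for `f > 0`;
* `Kerr.stressEnergy_smul_outVector_nonneg` — hence, by the dominant energy condition for future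
  causal multipliers (`LorentzianMetric.stressEnergy_nonneg_of_isFutureDirected`,
  `KerrLeafEnergyComparison.lean`), **`0 ≤ T[ψ](f m, W)` for every future-directed timelike `W`**
  and `f ≥ 0` — in particular for the normals `W = −g♯d(t* − h♯_{R₁})` of the leaves `Σ̃_τ(h♯_{R₁})`
  (`Kerr.stressEnergy_smul_outVector_leafNormal_scriHeight_nonneg`, `|a| < M`, `R₁ > 2M`) and for
  `W = V` (the time slices): the energy fluxes of the `r^p`-current through the leaves and through
  the time cut-offs are nonnegative, which is what allows the truncation of the far region by
  `{t* ≤ T*}` to be removed by monotone convergence (`KerrSchildTruncatedCurrent.lean`) in the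
  `r^p` identities exactly as in the `∂_{t*}`-energy identity of `KerrFarLeafEnergy.lean`.

(The coordinate forms of these fluxes, in the frame functionals of `dψ`, are in
`KerrNullFrameFlux.lean`.) No named facts (D-0026).

## References

* M. Dafermos, I. Rodnianski, arXiv:0910.4957, §3–§4 (key `DafermosRodnianski2010ICMP`).
* S. W. Hawking, G. F. R. Ellis, *The large scale structure of space-time* (1973), §4.3 (dominant
  energy condition) (key `HawkingEllis1973`).
* M. Dafermos, I. Rodnianski, Y. Shlapentokh-Rothman, arXiv:1402.7034, §2.3.1, §3.3 (key
  `DafermosRodnianskiShlapentokhrothman2014`).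
-/

noncomputable section

open Bundle Set TopologicalSpace Filter
open scoped Manifold ContDiff Topology

namespace Literature.Geometry.Lorentzian

namespace Kerr

/-- `m⁰ = 1 + 2H ≠ 0` for `M ≥ 0`: the outgoing null vector is not zero. [folklore] -/
theorem outVector_ne_zero {M : ℝ} (hM : 0 ≤ M) (a : ℝ) (x : E4) : outVector M a x ≠ 0 := by
  intro h
  have h0 := congrArg (fun v : E4 ↦ v 0) h
  simp only [outVector_apply_zero, PiLp.zero_apply] at h0
  linarith [scalarH_nonneg hM a x]

variable [Facts]

/-- **`m` is future-directed causal on the exterior** (`g(m, m) = 0`, `g(V, m) = −(1 + 2H) < 0`), for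
the Kerr time orientation `V = −g♯dt*` and `M ≥ 0`. [cite: DafermosRodnianski2010ICMP, §4] -/
theorem isFutureDirected_outVector {M a : ℝ} (hM : 0 ≤ M) (x : region a (rPlus M a)) :
    ((timeOrientation M a (rPlus M a) hM).ofLE le_top :
      TimeOrientation (smoothMetric M a (rPlus M a))).IsFutureDirected (x := x)
        (outVector M a x.1) := by
  have hx := radius_pos_of_mem_region x.2
  refine ⟨⟨?_, outVector_ne_zero hM a x.1⟩, ?_⟩
  · show bilin M a x.1 (outVector M a x.1) (outVector M a x.1) ≤ 0
    rw [bilin_outVector_outVector hx]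
  · show bilin M a x.1 (timeVector M a x.1) (outVector M a x.1) < 0
    rw [bilin_timeVector hx, outVector_apply_zero]
    linarith [scalarH_nonneg hM a x.1]

/-- `f m` is future-directed causal for `f > 0`. [folklore] -/
theorem isFutureDirected_smul_outVector {M a : ℝ} (hM : 0 ≤ M) (x : region a (rPlus M a))
    {f : ℝ} (hf : 0 < f) :
    ((timeOrientation M a (rPlus M a) hM).ofLE le_top :
      TimeOrientation (smoothMetric M a (rPlus M a))).IsFutureDirected (x := x)
        (f • (outVector M a x.1 : TangentSpace 𝓘(ℝ, E4) x)) :=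
  (isFutureDirected_outVector hM x).smul_pos _ hf

/-- **The dominant energy condition for the `r^p` multiplier**: `0 ≤ T[ψ](f m, W)` at every
exterior point, for every future-directed timelike `W`, `f ≥ 0` and `M ≥ 0`
(`LorentzianMetric.stressEnergy_nonneg_of_isFutureDirected` with the future null `m`; `f = 0`
trivially). [cite: HawkingEllis1973, §4.3] -/
theorem stressEnergy_smul_outVector_nonneg {M a : ℝ} (hM : 0 ≤ M) (x : region a (rPlus M a))
    {W : E4}
    (hW : ((timeOrientation M a (rPlus M a) hM).ofLE le_top :
      TimeOrientation (smoothMetric M a (rPlus M a))).IsFutureDirected (x := x) W)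
    (hWt : (smoothMetric M a (rPlus M a)).IsTimelike (x := x) W) {f : ℝ} (hf : 0 ≤ f)
    (ψ : region a (rPlus M a) → ℝ) :
    0 ≤ (smoothMetric M a (rPlus M a)).stressEnergy ψ x (f • (outVector M a x.1 : TangentSpace 𝓘(ℝ, E4) x)) W := by
  have h := LorentzianMetric.stressEnergy_nonneg_of_isFutureDirected _ (isFutureDirected_outVector hM x)
    hW hWt ψ
  have h1 := LinearMap.map_smul ((smoothMetric M a (rPlus M a)).stressEnergy ψ x) f
    (outVector M a x.1 : TangentSpace 𝓘(ℝ, E4) x)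
  have h2 := congrArg (fun L : TangentSpace 𝓘(ℝ, E4) x →ₗ[ℝ] ℝ ↦ L W) h1
  simp only [LinearMap.smul_apply, smul_eq_mul] at h2
  -- `h2 : T (f • m) W = f * T m W`, up to the (definitionally equal) module instances
  refine le_of_le_of_eq (mul_nonneg hf h) ?_
  exact h2.symm

/-- **Through the leaves `Σ̃_τ(h♯_{R₁})` the `r^p`-current has nonnegative energy**: for `|a| < M`,
`R₁ > 2M`, `f ≥ 0`, at every exterior point, `0 ≤ T[ψ](f m, W)` with `W = −g♯d(t* − h♯_{R₁})` the
(future-directed timelike) leaf normal (`Kerr.isTimelike_leafNormal_scriHeight`,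
`Kerr.isFutureDirected_leafNormal_scriHeight`). [cite: DafermosRodnianskiShlapentokhrothman2014, §3.3] -/
theorem stressEnergy_smul_outVector_leafNormal_scriHeight_nonneg {M a R₁ : ℝ} (hMa : IsSubextremal M a)
    (hR : 2 * M < R₁) (x : region a (rPlus M a)) {f : ℝ} (hf : 0 ≤ f)
    (ψ : region a (rPlus M a) → ℝ) :
    0 ≤ (smoothMetric M a (rPlus M a)).stressEnergy ψ x (f • (outVector M a x.1 : TangentSpace 𝓘(ℝ, E4) x))
        (leafNormal M a (scriHeight M a R₁) x) :=
  stressEnergy_smul_outVector_nonneg hMa.pos.le x (isFutureDirected_leafNormal_scriHeight hMa hR x)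
    (isTimelike_leafNormal_scriHeight hMa hR x) hf ψ

/-- **Through the time slices the `r^p`-current has nonnegative energy**: `0 ≤ T[ψ](f m, V)`,
`V = −g♯dt*`, for `f ≥ 0`, `M ≥ 0`. [cite: DafermosRodnianskiShlapentokhrothman2014, §2.3.1] -/
theorem stressEnergy_smul_outVector_timeVector_nonneg {M a : ℝ} (hM : 0 ≤ M) (x : region a (rPlus M a))
    {f : ℝ} (hf : 0 ≤ f) (ψ : region a (rPlus M a) → ℝ) :
    0 ≤ (smoothMetric M a (rPlus M a)).stressEnergy ψ x (f • (outVector M a x.1 : TangentSpace 𝓘(ℝ, E4) x))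
        (timeVector M a x.1) :=
  stressEnergy_smul_outVector_nonneg hM x (isFutureDirected_timeVector hM x).2
    (isFutureDirected_timeVector hM x).1 hf ψ

end Kerr

end Literature.Geometry.Lorentzian
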